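import Summits.AtomisticToContinuum.BoseEinsteinCondensation.Theses.BECWallDressingTransfer
import Summits.AtomisticToContinuum.BoseEinsteinCondensation.Theorems.BECCutLineWeakDisorderGroundStateRigidityUniqueOfRigid
import Summits.AtomisticToContinuum.BoseEinsteinCondensation.Theorems.BECCutLineWeakDisorderGroundStateRigidityStubFiniteEnergyLowDensity

/-!
# Crux `GroundStatePair` (stmt-AtomisticToContinuum-13827) — birth skeleton (BC3), line `birth`

Route of record: `route-AtomisticToContinuum-BECWallDressingTransfer` (crux rank 4; decl
`Summit.AtomisticToContinuum.BoseEinsteinCondensation.Theses.BECWallDressingTransfer.GroundStatePair`).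

The crux, per admissible `v` and wall margin `a ≥ 0`, at all small densities `ρ` and eventually in `N`
(`L = sideLength ρ (N+1)`):
* (D) `HasUniqueGroundState v (N+1) L` — the Dirichlet ground state of `N+1` bosons in the box exists
  (nonnegative representative) and is unique up to phase;
* (T) the TORUS INTERFACE of side `L + a` is inhabited: a continuous, `(L+a)`-periodic, nonnegative
  `Φ₀ : Config (N+1) → ℝ` such that every periodic `δ`-near-minimiser is `η'`-close in `L²(cell)` to
  `e^{iθ} Φ₀` for a suitable `δ = δ(η') > 0`.

## The cut (three registered stubs, all load-bearing)

* `stub_groundStateRigidity` — the route's OWN crux `GroundStateRigidity` (shared item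
  stmt-AtomisticToContinuum-9072) BY NAME: Dirichlet near-minimisers are mutually `L²`-close up to a
  phase at low density, eventually in `N`. Together with the LANDED tree theorems
  `Theorems.GroundStateRigidity.stub_finiteEnergyLowDensity` (`E₀ < ⊤` eventually at low density,
  Ruelle) and `Theorems.GroundStateRigidity.hasUniqueGroundState_of_rigid` (`E₀ < ⊤` + rigidity at
  `(v, N, L)` ⟹ `HasUniqueGroundState v N L`: existence by Rellich compactness + diamagnetic smoothing,
  uniqueness by passing rigidity to the `L²`-limits) it yields half (D) after the index shift
  `N ↦ N + 1` (`eventually_hasUniqueGroundState_of_rigidity`, sorry-free). So (D) costs the route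
  nothing beyond 9072.
* `stub_torusRigidity : TorusRigidity` — the TORUS TWIN of 9072 at side `sideLength ρ N + a`: for
  every `η > 0` some `δ > 0` makes any two periodic `δ`-near-minimisers `η`-close in `L²(cell)` up to
  a phase `e^{iθ}` (compact resolvent of the torus Hamiltonian + simplicity of the bosonic ground
  state: Perron–Frobenius for locally bounded `v` — cf. the Literature facts
  `PeriodicGroundStateNondegenerate(Integrable)` — and, for hard cores, connectedness of the free
  region on the torus at low density: the open kernel shared with 9072).
* `stub_torusProfile : TorusProfile` — existence of the PROFILE: a continuous, periodic, nonnegative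
  `Φ₀` that is an `L²(cell)`-cluster point of the periodic near-minimisers at every slack
  (minimising sequence + Rellich on the torus + diamagnetic `|·|`; continuity = elliptic regularity /
  strong Feller, the crux's own why-might-fail for wild measurable `v`). No uniqueness inside.

## The composition (sorry-free)

`interface_of_rigidity_of_profile`: rigidity at `η'/4` and a profile approximant at `(η'/4, δ)` give
the interface at `η'` by `|a + b|² ≤ 2|a|² + 2|b|²` (`Theorems.GroundStateRigidity.coe_nnnorm_add_sq_le`)
under `∫⁻ · in cellN`. `GroundStatePair_of : GroundStateRigidity → TorusRigidity → TorusProfile →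
GroundStatePair`: minimum of the three density thresholds, `Filter.Eventually.and`, index shift by
`tendsto_add_atTop_nat 1`. Direct `sorry` only inside the three `stub_*`.

References: Reed–Simon IV §XIII.12 Thms XIII.43–XIII.48, Thm XIII.64; Kato 1966 VI §1; LSSY 2005
§1.2, Ch. 2, Ch. 7; Ruelle 1969 §3.5.11.
-/

noncomputable section

open MeasureTheory Filter
open scoped ENNReal NNReal

namespace Summit.AtomisticToContinuum.BoseEinsteinCondensation.Cruxes.GroundStatePair.Birth

open Literature.MathematicalPhysics.QuantumManyBody.BoseGas

/-! ## Stub statements -/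

/-- **Torus rigidity** (torus twin of `GroundStateRigidity`, stmt-9072, on the enlarged torus of side
`sideLength ρ N + a`): for every repulsive finite-range `v` and `a ≥ 0` there is `ρ₀ > 0` such that for
`0 < ρ < ρ₀` and all large `N`, for every `η > 0` some `δ > 0` makes any two periodic `δ`-near-minimisers
`Φ, Ψ` of `N` bosons on the torus of side `sideLength ρ N + a` satisfy
`∫_cell |Φ - e^{iθ} Ψ|² ≤ η` for some real `θ` (finite `E₀^per`, compact resolvent, simple bosonic
ground state). [cite: ReedSimonIV1978, §XIII.12 Thms XIII.43–XIII.47 and Thm XIII.64] -/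
def TorusRigidity : Prop :=
  ∀ v : ℝ → ℝ≥0∞, IsRepulsiveFiniteRange v → ∀ a : ℝ, 0 ≤ a →
    ∃ ρ₀ : ℝ, 0 < ρ₀ ∧ ∀ ρ : ℝ, 0 < ρ → ρ < ρ₀ → ∀ᶠ N : ℕ in atTop,
      ∀ η : ℝ, 0 < η → ∃ δ : ℝ≥0∞, 0 < δ ∧
        ∀ Φ Ψ : PeriodicTrialState N (sideLength ρ N + a),
          periodicEnergy v Φ ≤ periodicGroundStateEnergy v N (sideLength ρ N + a) + δ →
          periodicEnergy v Ψ ≤ periodicGroundStateEnergy v N (sideLength ρ N + a) + δ →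
          ∃ θ : ℝ, ∫⁻ X in cellN N (sideLength ρ N + a),
            (‖Φ.ψ X - Complex.exp (↑θ * Complex.I) * Ψ.ψ X‖₊ : ℝ≥0∞) ^ 2 ≤ ENNReal.ofReal η

/-- **Torus profile** (existence + regularity, no uniqueness): for every repulsive finite-range `v` and
`a ≥ 0` there is `ρ₀ > 0` such that for `0 < ρ < ρ₀` and all large `N` there is a continuous,
`(sideLength ρ N + a)`-periodic, nonnegative `Φ₀ : Config N → ℝ` which is an `L²(cell)`-cluster point of
the periodic near-minimisers at every slack: for every `ε > 0` and `δ > 0` some periodic trial state of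
energy `≤ E₀^per + δ` is within `ε` (squared `L²(cell)` distance) of `Φ₀` (minimising sequence,
Rellich–Kondrachov on the torus, diamagnetic smoothing; continuity by elliptic regularity).
[cite: ReedSimonIV1978, §XIII.12 Thm XIII.46 and Thm XIII.64] -/
def TorusProfile : Prop :=
  ∀ v : ℝ → ℝ≥0∞, IsRepulsiveFiniteRange v → ∀ a : ℝ, 0 ≤ a →
    ∃ ρ₀ : ℝ, 0 < ρ₀ ∧ ∀ ρ : ℝ, 0 < ρ → ρ < ρ₀ → ∀ᶠ N : ℕ in atTop,
      ∃ Φ₀ : Config N → ℝ, Continuous Φ₀ ∧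
        (∀ (X : Config N) (i : Fin N) (k : Fin 3),
          Φ₀ (X + Pi.single i (EuclideanSpace.single k (sideLength ρ N + a))) = Φ₀ X) ∧
        (∀ X, 0 ≤ Φ₀ X) ∧
        ∀ ε : ℝ, 0 < ε → ∀ δ : ℝ≥0∞, 0 < δ →
          ∃ Φ : PeriodicTrialState N (sideLength ρ N + a),
            periodicEnergy v Φ ≤ periodicGroundStateEnergy v N (sideLength ρ N + a) + δ ∧
            ∫⁻ X in cellN N (sideLength ρ N + a),
              (‖Φ.ψ X - (Φ₀ X : ℂ)‖₊ : ℝ≥0∞) ^ 2 ≤ ENNReal.ofReal ε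

/-! ## Registered stubs -/

/-- **Registered stub 1 — Dirichlet rigidity** = the route's crux `GroundStateRigidity`
(stmt-AtomisticToContinuum-9072) BY NAME, so closing 9072 closes this stub: at low density and for all
large `N`, any two `δ`-near-minimisers of the Dirichlet energy in the box of side `(N/ρ)^{1/3}` are
`η`-close in `L²` up to a unit constant. Size M for locally bounded `v` (in tree up to wiring), open for
hard cores (connectedness of the dilute hard-sphere configuration space in the cube).
[cite: ReedSimonIV1978, §XIII.12 Thm XIII.47] -/
theorem stub_groundStateRigidity : Theses.BECWallDressingTransfer.GroundStateRigidity := by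
  sorry

/-- **Registered stub 2 — torus rigidity** (`TorusRigidity`, docstring above). Size M–L.
[cite: ReedSimonIV1978, §XIII.12 Thms XIII.43–XIII.47] -/
theorem stub_torusRigidity : TorusRigidity := by
  sorry

/-- **Registered stub 3 — torus profile** (`TorusProfile`, docstring above). Size M–L.
[cite: ReedSimonIV1978, §XIII.12 Thm XIII.46 and Thm XIII.64] -/
theorem stub_torusProfile : TorusProfile := by
  sorry

/-! ## Glue (proved) -/

/-- **Half (D) from Dirichlet rigidity.** `GroundStateRigidity` and the landed
`stub_finiteEnergyLowDensity`, `hasUniqueGroundState_of_rigid` give, for every admissible `v`, a density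
threshold below which `HasUniqueGroundState v (N+1) (sideLength ρ (N+1))` holds for all large `N`.
[folklore] -/
theorem eventually_hasUniqueGroundState_of_rigidity
    (hR : Theses.BECWallDressingTransfer.GroundStateRigidity) {v : ℝ → ℝ≥0∞}
    (hv : IsRepulsiveFiniteRange v) :
    ∃ ρ₀ : ℝ, 0 < ρ₀ ∧ ∀ ρ : ℝ, 0 < ρ → ρ < ρ₀ → ∀ᶠ N : ℕ in atTop,
      HasUniqueGroundState v (N + 1) (sideLength ρ (N + 1)) := by
  obtain ⟨ρ₁, hρ₁, H₁⟩ := Theorems.GroundStateRigidity.stub_finiteEnergyLowDensity v hv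
  obtain ⟨ρ₂, hρ₂, H₂⟩ := hR v hv
  refine ⟨min ρ₁ ρ₂, lt_min hρ₁ hρ₂, fun ρ hρ hlt => ?_⟩
  have h₁₂ : ∀ᶠ N : ℕ in atTop, HasUniqueGroundState v N (sideLength ρ N) := by
    filter_upwards [H₁ ρ hρ (hlt.trans_le (min_le_left _ _)),
      H₂ ρ hρ (hlt.trans_le (min_le_right _ _))] with N hE hRN
    exact Theorems.GroundStateRigidity.hasUniqueGroundState_of_rigid N v _ hE hRN
  exact (tendsto_add_atTop_nat 1).eventually h₁₂

/-- **The torus interface from torus rigidity and a profile** at one `(v, n, T, Φ₀)`: rigidity at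
tolerance `η'/4` and a profile approximant at `(η'/4, δ)` put every `δ`-near-minimiser within `η'` of
`e^{iθ} Φ₀` in `L²(cell)`, by `|a + b|² ≤ 2|a|² + 2|b|²`. [folklore] -/
theorem interface_of_rigidity_of_profile {n : ℕ} {v : ℝ → ℝ≥0∞} {T : ℝ} {Φ₀ : Config n → ℝ}
    (hΦ₀ : Continuous Φ₀)
    (hrig : ∀ η : ℝ, 0 < η → ∃ δ : ℝ≥0∞, 0 < δ ∧ ∀ Φ Ψ : PeriodicTrialState n T,
      periodicEnergy v Φ ≤ periodicGroundStateEnergy v n T + δ →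
      periodicEnergy v Ψ ≤ periodicGroundStateEnergy v n T + δ →
      ∃ θ : ℝ, ∫⁻ X in cellN n T,
        (‖Φ.ψ X - Complex.exp (↑θ * Complex.I) * Ψ.ψ X‖₊ : ℝ≥0∞) ^ 2 ≤ ENNReal.ofReal η)
    (happrox : ∀ ε : ℝ, 0 < ε → ∀ δ : ℝ≥0∞, 0 < δ → ∃ Φ : PeriodicTrialState n T,
      periodicEnergy v Φ ≤ periodicGroundStateEnergy v n T + δ ∧
      ∫⁻ X in cellN n T, (‖Φ.ψ X - (Φ₀ X : ℂ)‖₊ : ℝ≥0∞) ^ 2 ≤ ENNReal.ofReal ε) :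
    ∀ η' : ℝ, 0 < η' → ∃ δ : ℝ≥0∞, 0 < δ ∧ ∀ Φ : PeriodicTrialState n T,
      periodicEnergy v Φ ≤ periodicGroundStateEnergy v n T + δ →
      ∃ θ : ℝ, ∫⁻ X in cellN n T,
        (‖Φ.ψ X - Complex.exp (↑θ * Complex.I) * (Φ₀ X : ℂ)‖₊ : ℝ≥0∞) ^ 2 ≤ ENNReal.ofReal η' := by
  intro η' hη'
  obtain ⟨δ, hδ, hr⟩ := hrig (η' / 4) (by positivity)
  obtain ⟨Φ₁, hΦ₁E, hΦ₁⟩ := happrox (η' / 4) (by positivity) δ hδ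
  refine ⟨δ, hδ, fun Φ hΦE => ?_⟩
  obtain ⟨θ, hθ⟩ := hr Φ Φ₁ hΦE hΦ₁E
  refine ⟨θ, ?_⟩
  set c : ℂ := Complex.exp (↑θ * Complex.I) with hc
  have hc1 : (‖c‖₊ : ℝ≥0∞) = 1 :=
    coe_nnnorm_eq_one_of_norm_eq_one (by rw [hc]; exact Complex.norm_exp_ofReal_mul_I θ)
  -- pointwise two-term bound
  have hpt : ∀ X, (‖Φ.ψ X - c * (Φ₀ X : ℂ)‖₊ : ℝ≥0∞) ^ 2 ≤
      2 * (‖Φ.ψ X - c * Φ₁.ψ X‖₊ : ℝ≥0∞) ^ 2 + 2 * (‖Φ₁.ψ X - (Φ₀ X : ℂ)‖₊ : ℝ≥0∞) ^ 2 := by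
    intro X
    have hsplit : Φ.ψ X - c * (Φ₀ X : ℂ) =
        (Φ.ψ X - c * Φ₁.ψ X) + c * (Φ₁.ψ X - (Φ₀ X : ℂ)) := by ring
    rw [hsplit]
    refine (Theorems.GroundStateRigidity.coe_nnnorm_add_sq_le _ _).trans ?_
    rw [nnnorm_mul, ENNReal.coe_mul, hc1, one_mul]
  -- measurability of the two integrands
  have hm1 : Measurable fun X => (‖Φ.ψ X - c * Φ₁.ψ X‖₊ : ℝ≥0∞) ^ 2 :=
    (Φ.contDiff.continuous.measurable.sub
      (measurable_const.mul Φ₁.contDiff.continuous.measurable)).nnnorm.coe_nnreal_ennreal.pow_const _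
  have hm2 : Measurable fun X => (‖Φ₁.ψ X - (Φ₀ X : ℂ)‖₊ : ℝ≥0∞) ^ 2 :=
    (Φ₁.contDiff.continuous.measurable.sub
      (Complex.continuous_ofReal.measurable.comp hΦ₀.measurable)).nnnorm.coe_nnreal_ennreal.pow_const _
  have hx : 2 * ENNReal.ofReal (η' / 4) = ENNReal.ofReal (η' / 2) := by
    rw [show η' / 2 = 2 * (η' / 4) by ring, ENNReal.ofReal_mul (by norm_num : (0 : ℝ) ≤ 2),
      ENNReal.ofReal_ofNat]
  calc ∫⁻ X in cellN n T, (‖Φ.ψ X - c * (Φ₀ X : ℂ)‖₊ : ℝ≥0∞) ^ 2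
      ≤ ∫⁻ X in cellN n T, (2 * (‖Φ.ψ X - c * Φ₁.ψ X‖₊ : ℝ≥0∞) ^ 2 +
          2 * (‖Φ₁.ψ X - (Φ₀ X : ℂ)‖₊ : ℝ≥0∞) ^ 2) := lintegral_mono fun X => hpt X
    _ = 2 * (∫⁻ X in cellN n T, (‖Φ.ψ X - c * Φ₁.ψ X‖₊ : ℝ≥0∞) ^ 2) +
          2 * (∫⁻ X in cellN n T, (‖Φ₁.ψ X - (Φ₀ X : ℂ)‖₊ : ℝ≥0∞) ^ 2) := by
        rw [lintegral_add_left (hm1.const_mul 2), lintegral_const_mul _ hm1,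
          lintegral_const_mul _ hm2]
    _ ≤ 2 * ENNReal.ofReal (η' / 4) + 2 * ENNReal.ofReal (η' / 4) := by gcongr
    _ = ENNReal.ofReal η' := by
        rw [hx, ← ENNReal.ofReal_add (by positivity) (by positivity), add_halves]

/-! ## The composition: the crux BY NAME from the three stub statements -/

/-- **`GroundStatePair` (the route decl, BY NAME) from the three stub statements** — kernel-checked,
no `sorry`: half (D) from Dirichlet rigidity (`eventually_hasUniqueGroundState_of_rigidity`), half (T)
from torus rigidity + profile (`interface_of_rigidity_of_profile`) after the index shift `N ↦ N + 1`;
density threshold = the minimum of the three. [folklore] -/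
theorem GroundStatePair_of :
    Theses.BECWallDressingTransfer.GroundStateRigidity → TorusRigidity → TorusProfile →
      Theses.BECWallDressingTransfer.GroundStatePair := by
  intro hR hT₁ hT₂ v hv a ha
  obtain ⟨ρD, hρD, HD⟩ := eventually_hasUniqueGroundState_of_rigidity hR hv
  obtain ⟨ρ₁, hρ₁, H₁⟩ := hT₁ v hv a ha
  obtain ⟨ρ₂, hρ₂, H₂⟩ := hT₂ v hv a ha
  refine ⟨min ρD (min ρ₁ ρ₂), lt_min hρD (lt_min hρ₁ hρ₂), fun ρ hρ hlt => ?_⟩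
  have hD := HD ρ hρ (hlt.trans_le (min_le_left _ _))
  have h₁ := (tendsto_add_atTop_nat 1).eventually
    (H₁ ρ hρ (hlt.trans_le ((min_le_right _ _).trans (min_le_left _ _))))
  have h₂ := (tendsto_add_atTop_nat 1).eventually
    (H₂ ρ hρ (hlt.trans_le ((min_le_right _ _).trans (min_le_right _ _))))
  filter_upwards [hD, h₁, h₂] with N hDN h₁N h₂N
  obtain ⟨Φ₀, hcont, hper, hnn, happrox⟩ := h₂N
  exact ⟨hDN, Φ₀, hcont, hper, hnn, interface_of_rigidity_of_profile hcont h₁N happrox⟩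

/-- The skeleton closes the crux the day the three stubs are theorems (today: modulo their `sorry`s).
[folklore] -/
theorem groundStatePair_of_stubs : Theses.BECWallDressingTransfer.GroundStatePair :=
  GroundStatePair_of stub_groundStateRigidity stub_torusRigidity stub_torusProfile

end Summit.AtomisticToContinuum.BoseEinsteinCondensation.Cruxes.GroundStatePair.Birth

end
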